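import Literature.NumberTheory.Transcendental.CurvePeriodsHomotopyProofs
import Mathlib.Analysis.Calculus.ContDiff.Deriv
import HarnessLib

/-!
# Periods of curve type: reparametrisation, subdivision and concatenation of paths

Companion of `Literature/NumberTheory/Transcendental/CurvePeriods.lean` (Huber–Wüstholz 2022,
Thm. 13.3 (2), rendered on explicit period symbols `(Z, ω, γ)` with the elementary relations
(R1)–(R5), `CurvePeriods.IsElementaryRelation`; the general statement is the named fact
`HuberWustholzCurvePeriods`). In the book the third slot of a period symbol is a class of the
relative singular homology `H₁^sing(Z^an, D; ℚ)`, represented by smooth paths (§3.3.1, pp. 42–44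
of the held text), and the only relations imposed on paths in the elementary rendering are the
boundaries (R5) of `C¹` triangles with algebraic vertices. `CurvePeriodsHomotopyProofs.lean`
derives homotopy invariance with fixed end points from (R5). This file adds, for an ARBITRARY
smooth affine curve `Z` over `ℚ̄`, the remaining pieces of the elementary path calculus which
make `γ ↦ (Z, ω, γ) mod relations` additive on the groupoid of `C¹` paths between algebraic
points of `Z(ℂ)` — the path-side half of the comparison between the elementary rendering and
the formal period space of the book (used, in every genus, to replace a path by a sum of
standard ones):

* `CurvePath.reparam`, `span_single_sub_single_of_reparam` — **reparametrisation invariance**: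
  `(Z, ω, γ ∘ φ) ∼ (Z, ω, γ)` for every `C¹` map `φ : [0,1] → [0,1]` with `φ(0) = 0`, `φ(1) = 1`
  (the homotopy `γ((1 − s)φ(t) + st)` with fixed end points);
* `rel_subdivision`, `CurvePath.firstPiece`, `CurvePath.secondPiece` — **subdivision**: if
  `γ(c)` is an algebraic point, `c ∈ [0,1]`, then
  `(Z, ω, γ|[0,c]) + (Z, ω, γ|[c,1]) − (Z, ω, γ)` IS an elementary relation (the triangle
  `τ(a, b) = γ(ca + b)`), the pieces being reparametrised linearly by `[0,1]`;
* `contDiffOn_Icc_of_derivWithin_eq` — `C¹` gluing on consecutive intervals; `smoothStep`, the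
  cubic `φ(t) = 3t² − 2t³` with `φ′(0) = φ′(1) = 0`;
* `CurvePath.concat`, `span_concat` — **concatenation**: two `C¹` paths `γ₁` from `P` to `Q` and
  `γ₂` from `Q` to `R` on `Z` have the `C¹` concatenation `γ₁ ⋆ γ₂ = (γ₁ ∘ φ)(2t) ⊔ (γ₂ ∘ φ)(2t − 1)`
  from `P` to `R`, and `(Z, ω, γ₁ ⋆ γ₂) ∼ (Z, ω, γ₁) + (Z, ω, γ₂)` (subdivision at `c = 1/2` and two
  reparametrisations);
* `CurvePath.reverse`, `span_single_add_single_reverse`, `span_conj` — reversal as a definition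
  and **conjugation invariance** `(Z, ω, δ ⋆ ℓ ⋆ δ⁻) ∼ (Z, ω, ℓ)` for a loop `ℓ` and a path `δ` to
  its base point.

Everything is transcendence-free and uniform in `Z`.

## References

* A. Huber, G. Wüstholz, *Transcendence and Linear Relations of 1-Periods*, Cambridge Tracts in
  Mathematics 227, CUP 2022 [HuberWustholz2022]: §3.3.1 (pp. 42–44 of the held text: relative
  singular homology by smooth paths, homotopy), Def. 7.6 (p. 63), Thm. 13.3 (2) (p. 121).
-/

noncomputable section

open scoped BigOperators Topology
open MvPolynomial Set Filter

namespace Literature.NumberTheory.Transcendental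

namespace CurvePeriods

set_option quotPrecheck false in
/-- Membership in the `ℚ̄`-span of the elementary relations, in the format of the conclusion of
`HuberWustholzCurvePeriods`. -/
local notation "InSpan" c:max => ∃ (k : ℕ) (ρ : Fin k → (PeriodSymbol →₀ ℂ)) (a : Fin k → ℂ),
  (∀ l, IsElementaryRelation (ρ l)) ∧ (∀ l, IsAlgebraic ℚ (a l)) ∧ c = ∑ l, a l • ρ l

variable {Z : CurveData}

/-! ### Reparametrisation invariance -/

/-- The reparametrised path `γ ∘ φ` for a `C¹` map `φ : [0,1] → [0,1]` fixing `0` and `1`.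
[folklore] -/
def CurvePath.reparam (γ : CurvePath Z) (φ : ℝ → ℝ) (hφ : ContDiffOn ℝ 1 φ (Icc 0 1))
    (hφI : MapsTo φ (Icc 0 1) (Icc 0 1)) (hφ0 : φ 0 = 0) (hφ1 : φ 1 = 1) : CurvePath Z where
  toFun := fun t => γ.toFun (φ t)
  contDiffOn := γ.contDiffOn.comp hφ hφI
  mem_points := fun _ ht => γ.mem_points _ (hφI ht)
  algebraic_zero := fun i => by rw [hφ0]; exact γ.algebraic_zero i
  algebraic_one := fun i => by rw [hφ1]; exact γ.algebraic_one i

/-- **Reparametrisation invariance**: for a `C¹` map `φ : [0,1] → [0,1]` with `φ(0) = 0`,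
`φ(1) = 1` and any path `γ′` agreeing with `γ ∘ φ` on `[0,1]`, `(Z, ω, γ′) − (Z, ω, γ)` lies in the
span of the elementary relations (the `C¹` homotopy `H(s, t) = γ((1 − s)φ(t) + st)` with fixed
end points, `rel_of_homotopy`). [cite: HuberWustholz2022, §3.3.1 (pp. 42–44)] -/
theorem span_single_sub_single_of_reparam (hZ : Z.IsSmoothAffineCurve)
    (ω : Fin Z.n → MvPolynomial (Fin Z.n) ℂ) (h : ∀ i, HasAlgCoeffs (ω i)) (γ γ' : CurvePath Z)
    (φ : ℝ → ℝ) (hφ : ContDiffOn ℝ 1 φ (Icc 0 1)) (hφI : MapsTo φ (Icc 0 1) (Icc 0 1))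
    (hφ0 : φ 0 = 0) (hφ1 : φ 1 = 1) (hγ' : ∀ t ∈ Icc (0 : ℝ) 1, γ'.toFun t = γ.toFun (φ t)) :
    InSpan (Finsupp.single (⟨Z, hZ, ω, h, γ'⟩ : PeriodSymbol) (1 : ℂ) -
        Finsupp.single ⟨Z, hZ, ω, h, γ⟩ 1) := by
  -- the homotopy `H(s,t) = γ((1 − s) φ(t) + s t)` on the unit square
  have hψ : ContDiffOn ℝ 1 (fun q : ℝ × ℝ => (1 - q.1) * φ q.2 + q.1 * q.2)
      (Icc (0 : ℝ) 1 ×ˢ Icc (0 : ℝ) 1) := by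
    have hφ2 : ContDiffOn ℝ 1 (fun q : ℝ × ℝ => φ q.2) (Icc (0 : ℝ) 1 ×ˢ Icc (0 : ℝ) 1) :=
      hφ.comp contDiff_snd.contDiffOn fun q hq => hq.2
    exact ((contDiff_const.sub contDiff_fst).contDiffOn.mul hφ2).add
      (contDiff_fst.mul contDiff_snd).contDiffOn
  have hψI : MapsTo (fun q : ℝ × ℝ => (1 - q.1) * φ q.2 + q.1 * q.2)
      (Icc (0 : ℝ) 1 ×ˢ Icc (0 : ℝ) 1) (Icc 0 1) := fun q hq => by
    have hs := hq.1; have hu := hφI hq.2; have hv := hq.2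
    exact ⟨by nlinarith [hs.1, hs.2, hu.1, hv.1], by nlinarith [hs.1, hs.2, hu.2, hv.2]⟩
  refine span_single_sub_single_of_homotopy hZ ω h
    (fun q => γ.toFun ((1 - q.1) * φ q.2 + q.1 * q.2)) (γ.contDiffOn.comp hψ hψI)
    (fun q hq => γ.mem_points _ (hψI hq)) (fun s _ => ?_) (fun s _ => ?_) γ' γ (fun t ht => ?_)
    (fun t _ => ?_)
  · show γ.toFun ((1 - s) * φ 0 + s * 0) = γ.toFun ((1 - 0) * φ 0 + 0 * 0)
    rw [hφ0]; ring_nf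
  · show γ.toFun ((1 - s) * φ 1 + s * 1) = γ.toFun ((1 - 0) * φ 1 + 0 * 1)
    rw [hφ1]; ring_nf
  · rw [hγ' t ht]; show γ.toFun (φ t) = γ.toFun ((1 - 0) * φ t + 0 * t); ring_nf
  · show γ.toFun t = γ.toFun ((1 - 1) * φ t + 1 * t); ring_nf

/-- The reparametrised path itself: `(Z, ω, γ.reparam φ) − (Z, ω, γ)` is in the span.
[cite: HuberWustholz2022, §3.3.1 (pp. 42–44)] -/
theorem span_single_reparam_sub_single (hZ : Z.IsSmoothAffineCurve)
    (ω : Fin Z.n → MvPolynomial (Fin Z.n) ℂ) (h : ∀ i, HasAlgCoeffs (ω i)) (γ : CurvePath Z)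
    (φ : ℝ → ℝ) (hφ : ContDiffOn ℝ 1 φ (Icc 0 1)) (hφI : MapsTo φ (Icc 0 1) (Icc 0 1))
    (hφ0 : φ 0 = 0) (hφ1 : φ 1 = 1) :
    InSpan (Finsupp.single (⟨Z, hZ, ω, h, γ.reparam φ hφ hφI hφ0 hφ1⟩ : PeriodSymbol) (1 : ℂ) -
        Finsupp.single ⟨Z, hZ, ω, h, γ⟩ 1) :=
  span_single_sub_single_of_reparam hZ ω h γ _ φ hφ hφI hφ0 hφ1 fun _ _ => rfl

/-! ### Subdivision -/

/-- **Subdivision at an algebraic point is an elementary relation.** If `c ∈ [0,1]`, `γ₁` agrees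
on `[0,1]` with `t ↦ γ(ct)` and `γ₂` with `t ↦ γ(c + (1 − c)t)` (so `γ(c)` is an algebraic point),
then `(Z, ω, γ₁) + (Z, ω, γ₂) − (Z, ω, γ)` is the boundary (R5) of the `C¹` triangle
`τ(a, b) = γ(ca + b)`. [cite: HuberWustholz2022, §3.3.1 (pp. 42–44)] -/
theorem rel_subdivision (hZ : Z.IsSmoothAffineCurve)
    (ω : Fin Z.n → MvPolynomial (Fin Z.n) ℂ) (h : ∀ i, HasAlgCoeffs (ω i)) (γ γ₁ γ₂ : CurvePath Z)
    {c : ℝ} (hc : c ∈ Icc (0 : ℝ) 1) (h₁ : ∀ t ∈ Icc (0 : ℝ) 1, γ₁.toFun t = γ.toFun (c * t))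
    (h₂ : ∀ t ∈ Icc (0 : ℝ) 1, γ₂.toFun t = γ.toFun (c + (1 - c) * t)) :
    IsElementaryRelation
      (Finsupp.single (⟨Z, hZ, ω, h, γ₁⟩ : PeriodSymbol) (1 : ℂ) +
          Finsupp.single ⟨Z, hZ, ω, h, γ₂⟩ 1 - Finsupp.single ⟨Z, hZ, ω, h, γ⟩ 1) := by
  have hI : MapsTo (fun q : ℝ × ℝ => c * q.1 + q.2) stdTriangle (Icc 0 1) := fun q hq =>
    ⟨by nlinarith [hc.1, hq.1, hq.2.1], by nlinarith [hc.2, hq.1, hq.2.1, hq.2.2]⟩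
  have hτ : ContDiffOn ℝ 1 (fun q : ℝ × ℝ => γ.toFun (c * q.1 + q.2)) stdTriangle :=
    γ.contDiffOn.comp ((contDiff_const.mul contDiff_fst).add contDiff_snd).contDiffOn hI
  exact IsElementaryRelation.boundary Z hZ ω h (fun q : ℝ × ℝ => γ.toFun (c * q.1 + q.2)) hτ
    (fun q hq => γ.mem_points _ (hI hq)) γ₁ γ₂ γ
    (fun t ht => by rw [h₁ t ht]; show γ.toFun (c * t) = γ.toFun (c * t + 0); rw [add_zero])
    (fun t ht => by rw [h₂ t ht]; congr 1; ring)
    (fun t _ => by show γ.toFun t = γ.toFun (c * 0 + t); rw [mul_zero, zero_add])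

/-- The first piece `t ↦ γ(ct)` of a path subdivided at a parameter `c ∈ [0,1]` with `γ(c)`
algebraic. [folklore] -/
def CurvePath.firstPiece (γ : CurvePath Z) (c : ℝ) (hc : c ∈ Icc (0 : ℝ) 1)
    (halg : ∀ i, IsAlgebraic ℚ (γ.toFun c i)) : CurvePath Z where
  toFun := fun t => γ.toFun (c * t)
  contDiffOn := γ.contDiffOn.comp (contDiff_const.mul contDiff_id).contDiffOn fun t ht =>
    ⟨mul_nonneg hc.1 ht.1, mul_le_one₀ hc.2 ht.1 ht.2⟩
  mem_points := fun t ht => γ.mem_points _ ⟨mul_nonneg hc.1 ht.1, mul_le_one₀ hc.2 ht.1 ht.2⟩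
  algebraic_zero := fun i => by rw [mul_zero]; exact γ.algebraic_zero i
  algebraic_one := fun i => by rw [mul_one]; exact halg i

/-- `c + (1 − c)t ∈ [0,1]` for `c, t ∈ [0,1]`. [folklore] -/
theorem add_one_sub_mul_mem_Icc {c t : ℝ} (hc : c ∈ Icc (0 : ℝ) 1) (ht : t ∈ Icc (0 : ℝ) 1) :
    c + (1 - c) * t ∈ Icc (0 : ℝ) 1 :=
  ⟨by nlinarith [hc.1, hc.2, ht.1], by nlinarith [hc.1, hc.2, ht.2]⟩

/-- The second piece `t ↦ γ(c + (1 − c)t)` of a path subdivided at a parameter `c ∈ [0,1]` with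
`γ(c)` algebraic. [folklore] -/
def CurvePath.secondPiece (γ : CurvePath Z) (c : ℝ) (hc : c ∈ Icc (0 : ℝ) 1)
    (halg : ∀ i, IsAlgebraic ℚ (γ.toFun c i)) : CurvePath Z where
  toFun := fun t => γ.toFun (c + (1 - c) * t)
  contDiffOn := γ.contDiffOn.comp (contDiff_const.add (contDiff_const.mul contDiff_id)).contDiffOn
    fun _ ht => add_one_sub_mul_mem_Icc hc ht
  mem_points := fun _ ht => γ.mem_points _ (add_one_sub_mul_mem_Icc hc ht)
  algebraic_zero := fun i => by rw [mul_zero, add_zero]; exact halg i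
  algebraic_one := fun i => by rw [mul_one, add_sub_cancel]; exact γ.algebraic_one i

/-- **Subdivision**, for the two canonical pieces: `(Z, ω, γ|[0,c]) + (Z, ω, γ|[c,1]) − (Z, ω, γ)`
is an elementary relation. [cite: HuberWustholz2022, §3.3.1 (pp. 42–44)] -/
theorem rel_firstPiece_add_secondPiece_sub (hZ : Z.IsSmoothAffineCurve)
    (ω : Fin Z.n → MvPolynomial (Fin Z.n) ℂ) (h : ∀ i, HasAlgCoeffs (ω i)) (γ : CurvePath Z)
    (c : ℝ) (hc : c ∈ Icc (0 : ℝ) 1) (halg : ∀ i, IsAlgebraic ℚ (γ.toFun c i)) :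
    IsElementaryRelation
      (Finsupp.single (⟨Z, hZ, ω, h, γ.firstPiece c hc halg⟩ : PeriodSymbol) (1 : ℂ) +
          Finsupp.single ⟨Z, hZ, ω, h, γ.secondPiece c hc halg⟩ 1 -
        Finsupp.single ⟨Z, hZ, ω, h, γ⟩ 1) :=
  rel_subdivision hZ ω h γ _ _ hc (fun _ _ => rfl) fun _ _ => rfl

/-! ### `C¹` gluing and the cubic reparametrisation -/

/-- For `x < b < c`, the intervals `[a, b]` and `[a, c]` agree near `x`. [folklore] -/
theorem Icc_eventuallyEq_Icc_of_lt {a b c x : ℝ} (hxb : x < b) (hbc : b ≤ c) :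
    (Icc a b : Set ℝ) =ᶠ[𝓝 x] Icc a c :=
  Filter.eventuallyEq_set.mpr (eventually_of_mem (Iio_mem_nhds hxb) fun _ hy =>
    ⟨fun h => ⟨h.1, h.2.trans hbc⟩, fun h => ⟨h.1, le_of_lt hy⟩⟩)

/-- For `a ≤ b < x`, the intervals `[b, c]` and `[a, c]` agree near `x`. [folklore] -/
theorem Icc_eventuallyEq_Icc_of_gt {a b c x : ℝ} (hab : a ≤ b) (hbx : b < x) :
    (Icc b c : Set ℝ) =ᶠ[𝓝 x] Icc a c :=
  Filter.eventuallyEq_set.mpr (eventually_of_mem (Ioi_mem_nhds hbx) fun _ hy =>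
    ⟨fun h => ⟨hab.trans h.1, h.2⟩, fun h => ⟨le_of_lt hy, h.2⟩⟩)

/-- **`C¹` gluing on consecutive intervals**: a function which is `C¹` on `[a, b]` and on `[b, c]`
with matching one-sided derivatives at `b` is `C¹` on `[a, c]`. [folklore] -/
theorem contDiffOn_Icc_of_derivWithin_eq {F : Type*} [NormedAddCommGroup F] [NormedSpace ℝ F]
    {f : ℝ → F} {a b c : ℝ} (hab : a < b) (hbc : b < c)
    (h₁ : ContDiffOn ℝ 1 f (Icc a b)) (h₂ : ContDiffOn ℝ 1 f (Icc b c))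
    (hd : derivWithin f (Icc a b) b = derivWithin f (Icc b c) b) :
    ContDiffOn ℝ 1 f (Icc a c) := by
  have hac : a < c := hab.trans hbc
  rw [contDiffOn_one_iff_derivWithin (uniqueDiffOn_Icc hab)] at h₁
  rw [contDiffOn_one_iff_derivWithin (uniqueDiffOn_Icc hbc)] at h₂
  rw [contDiffOn_one_iff_derivWithin (uniqueDiffOn_Icc hac)]
  have hbI : b ∈ Icc a c := ⟨hab.le, hbc.le⟩
  -- at the junction
  have hjb : HasDerivWithinAt f (derivWithin f (Icc a b) b) (Icc a c) b := by
    have hl := (h₁.1 b ⟨hab.le, le_rfl⟩).hasDerivWithinAt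
    have hr := (h₂.1 b ⟨le_rfl, hbc.le⟩).hasDerivWithinAt
    rw [← hd] at hr
    have hu := hl.union hr
    rwa [Icc_union_Icc_eq_Icc hab.le hbc.le] at hu
  have hdb : derivWithin f (Icc a c) b = derivWithin f (Icc a b) b :=
    hjb.derivWithin (uniqueDiffOn_Icc hac b hbI)
  refine ⟨fun x hx => ?_, ?_⟩
  · rcases lt_trichotomy x b with hxb | rfl | hbx
    · exact (differentiableWithinAt_congr_set (Icc_eventuallyEq_Icc_of_lt hxb hbc.le)).mp
        (h₁.1 x ⟨hx.1, hxb.le⟩)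
    · exact hjb.differentiableWithinAt
    · exact (differentiableWithinAt_congr_set (Icc_eventuallyEq_Icc_of_gt hab.le hbx)).mp
        (h₂.1 x ⟨hbx.le, hx.2⟩)
  · refine (ContinuousOn.union_of_isClosed (h₁.2.congr fun x hx => ?_)
      (h₂.2.congr fun x hx => ?_) isClosed_Icc isClosed_Icc).mono
      (Icc_union_Icc_eq_Icc hab.le hbc.le).symm.subset
    · rcases lt_or_eq_of_le hx.2 with hxb | rfl
      · exact derivWithin_congr_set (Icc_eventuallyEq_Icc_of_lt hxb hbc.le).symm
      · exact hdb
    · rcases lt_or_eq_of_le hx.1 with hbx | rfl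
      · exact derivWithin_congr_set (Icc_eventuallyEq_Icc_of_gt hab.le hbx).symm
      · rw [← hd]; exact hdb

/-- The cubic `φ(t) = 3t² − 2t³` ("smooth step"): `φ(0) = 0`, `φ(1) = 1`, `φ′(0) = φ′(1) = 0`,
`φ([0,1]) ⊆ [0,1]`. [folklore] -/
def smoothStep (t : ℝ) : ℝ := t * t * (3 - 2 * t)

/-- `φ(0) = 0`. [folklore] -/
@[simp] theorem smoothStep_zero : smoothStep 0 = 0 := by simp [smoothStep]

/-- `φ(1) = 1`. [folklore] -/
@[simp] theorem smoothStep_one : smoothStep 1 = 1 := by norm_num [smoothStep]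

/-- `φ` is smooth. [folklore] -/
theorem contDiff_smoothStep {n : WithTop ℕ∞} : ContDiff ℝ n smoothStep :=
  (contDiff_id.mul contDiff_id).mul (contDiff_const.sub (contDiff_const.mul contDiff_id))

/-- `φ′(t) = 6t(1 − t)`. [folklore] -/
theorem hasDerivAt_smoothStep (t : ℝ) : HasDerivAt smoothStep (6 * t * (1 - t)) t := by
  have h1 : HasDerivAt (fun t : ℝ => t * t) (1 * t + t * 1) t := (hasDerivAt_id t).mul (hasDerivAt_id t)
  have h2 : HasDerivAt (fun t : ℝ => 3 - 2 * t) (-(2 * 1)) t :=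
    ((hasDerivAt_id t).const_mul 2).const_sub 3
  have h := h1.mul h2
  have he : (1 * t + t * 1) * (3 - 2 * t) + t * t * -(2 * 1) = 6 * t * (1 - t) := by ring
  rw [he] at h
  exact h

/-- `φ([0,1]) ⊆ [0,1]` (`φ(t) = t²(3 − 2t) ≥ 0` and `1 − φ(t) = (1 − t)²(1 + 2t) ≥ 0`).
[folklore] -/
theorem mapsTo_smoothStep : MapsTo smoothStep (Icc 0 1) (Icc 0 1) := fun t ht => by
  refine ⟨mul_nonneg (mul_self_nonneg t) (by linarith [ht.2]), ?_⟩
  have h : 1 - smoothStep t = (1 - t) ^ 2 * (1 + 2 * t) := by unfold smoothStep; ring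
  nlinarith [mul_nonneg (sq_nonneg (1 - t)) (by linarith [ht.1] : (0 : ℝ) ≤ 1 + 2 * t)]

/-! ### Concatenation -/

/-- `2t ∈ [0,1]` for `t ∈ [0, 1/2]`. [folklore] -/
theorem two_mul_mem_Icc {t : ℝ} (ht : t ∈ Icc (0 : ℝ) (1 / 2)) : 2 * t ∈ Icc (0 : ℝ) 1 :=
  ⟨by linarith [ht.1], by linarith [ht.2]⟩

/-- `2t − 1 ∈ [0,1]` for `t ∈ [1/2, 1]`. [folklore] -/
theorem two_mul_sub_one_mem_Icc {t : ℝ} (ht : t ∈ Icc (1 / 2 : ℝ) 1) :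
    2 * t - 1 ∈ Icc (0 : ℝ) 1 :=
  ⟨by linarith [ht.1], by linarith [ht.2]⟩

/-- **The `C¹` concatenation** `γ₁ ⋆ γ₂` of two `C¹` paths with `γ₁(1) = γ₂(0)`:
`γ₁(φ(2t))` on `[0, 1/2]` and `γ₂(φ(2t − 1))` on `[1/2, 1]`, `φ = smoothStep`; the vanishing of
`φ′` at `0` and `1` makes the junction `C¹`. [folklore] -/
def CurvePath.concat (γ₁ γ₂ : CurvePath Z) (hj : γ₁.toFun 1 = γ₂.toFun 0) : CurvePath Z where
  toFun := fun t => if t ≤ 1 / 2 then γ₁.toFun (smoothStep (2 * t))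
    else γ₂.toFun (smoothStep (2 * t - 1))
  contDiffOn := by
    have hg₁ : ContDiffOn ℝ 1 (fun t => γ₁.toFun (smoothStep (2 * t))) (Icc 0 (1 / 2)) :=
      γ₁.contDiffOn.comp (contDiff_smoothStep.comp (contDiff_const.mul contDiff_id)).contDiffOn
        fun t ht => mapsTo_smoothStep (two_mul_mem_Icc ht)
    have hg₂ : ContDiffOn ℝ 1 (fun t => γ₂.toFun (smoothStep (2 * t - 1))) (Icc (1 / 2) 1) :=
      γ₂.contDiffOn.comp
        (contDiff_smoothStep.comp ((contDiff_const.mul contDiff_id).sub contDiff_const)).contDiffOn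
        fun t ht => mapsTo_smoothStep (two_mul_sub_one_mem_Icc ht)
    have he₁ : EqOn (fun t => if t ≤ 1 / 2 then γ₁.toFun (smoothStep (2 * t))
        else γ₂.toFun (smoothStep (2 * t - 1))) (fun t => γ₁.toFun (smoothStep (2 * t)))
        (Icc 0 (1 / 2)) := fun t ht => if_pos ht.2
    have hhalf : γ₁.toFun (smoothStep (2 * (1 / 2))) = γ₂.toFun (smoothStep (2 * (1 / 2) - 1)) := by
      norm_num [hj]
    have he₂ : EqOn (fun t => if t ≤ 1 / 2 then γ₁.toFun (smoothStep (2 * t))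
        else γ₂.toFun (smoothStep (2 * t - 1))) (fun t => γ₂.toFun (smoothStep (2 * t - 1)))
        (Icc (1 / 2) 1) := fun t ht => by
      rcases lt_or_eq_of_le ht.1 with hlt | heq
      · exact if_neg (not_le.mpr hlt)
      · subst heq
        exact (if_pos le_rfl).trans hhalf
    refine contDiffOn_Icc_of_derivWithin_eq (by norm_num : (0 : ℝ) < 1 / 2)
      (by norm_num : (1 / 2 : ℝ) < 1) (hg₁.congr he₁) (hg₂.congr he₂) ?_
    -- both one-sided derivatives vanish at `t = 1/2`
    have hm : (1 / 2 : ℝ) ∈ Icc (0 : ℝ) (1 / 2) := ⟨by norm_num, le_rfl⟩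
    have hm' : (1 / 2 : ℝ) ∈ Icc (1 / 2 : ℝ) 1 := ⟨le_rfl, by norm_num⟩
    have hL : HasDerivWithinAt (fun t => if t ≤ 1 / 2 then γ₁.toFun (smoothStep (2 * t))
        else γ₂.toFun (smoothStep (2 * t - 1))) 0 (Icc 0 (1 / 2)) (1 / 2) := by
      have hγ : HasDerivWithinAt γ₁.toFun (derivWithin γ₁.toFun (Icc 0 1) 1) (Icc 0 1)
          (smoothStep (2 * (1 / 2))) := by
        rw [show smoothStep (2 * (1 / 2)) = 1 by norm_num]
        exact ((γ₁.contDiffOn.differentiableOn one_ne_zero) 1 ⟨zero_le_one, le_rfl⟩).hasDerivWithinAt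
      have hψ : HasDerivWithinAt (fun t : ℝ => smoothStep (2 * t)) 0 (Icc 0 (1 / 2)) (1 / 2) := by
        have h := (hasDerivAt_smoothStep (2 * (1 / 2))).comp (1 / 2 : ℝ)
          ((hasDerivAt_id (1 / 2 : ℝ)).const_mul 2)
        have h0 : 6 * (2 * (1 / 2 : ℝ)) * (1 - 2 * (1 / 2)) * (2 * 1) = 0 := by norm_num
        rw [h0] at h
        exact h.hasDerivWithinAt
      have hc := hγ.scomp (1 / 2 : ℝ) hψ fun t ht => mapsTo_smoothStep (two_mul_mem_Icc ht)
      rw [zero_smul] at hc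
      exact hc.congr he₁ (he₁ hm)
    have hR : HasDerivWithinAt (fun t => if t ≤ 1 / 2 then γ₁.toFun (smoothStep (2 * t))
        else γ₂.toFun (smoothStep (2 * t - 1))) 0 (Icc (1 / 2) 1) (1 / 2) := by
      have hγ : HasDerivWithinAt γ₂.toFun (derivWithin γ₂.toFun (Icc 0 1) 0) (Icc 0 1)
          (smoothStep (2 * (1 / 2) - 1)) := by
        rw [show smoothStep (2 * (1 / 2) - 1) = 0 by norm_num]
        exact ((γ₂.contDiffOn.differentiableOn one_ne_zero) 0 ⟨le_rfl, zero_le_one⟩).hasDerivWithinAt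
      have hψ : HasDerivWithinAt (fun t : ℝ => smoothStep (2 * t - 1)) 0 (Icc (1 / 2) 1)
          (1 / 2) := by
        have h := (hasDerivAt_smoothStep (2 * (1 / 2) - 1)).comp (1 / 2 : ℝ)
          (((hasDerivAt_id (1 / 2 : ℝ)).const_mul 2).sub_const 1)
        have h0 : 6 * (2 * (1 / 2 : ℝ) - 1) * (1 - (2 * (1 / 2) - 1)) * (2 * 1) = 0 := by norm_num
        rw [h0] at h
        exact h.hasDerivWithinAt
      have hc := hγ.scomp (1 / 2 : ℝ) hψ fun t ht => mapsTo_smoothStep (two_mul_sub_one_mem_Icc ht)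
      rw [zero_smul] at hc
      exact hc.congr he₂ (he₂ hm')
    rw [hL.derivWithin (uniqueDiffOn_Icc (by norm_num) _ hm),
      hR.derivWithin (uniqueDiffOn_Icc (by norm_num) _ hm')]
  mem_points := fun t ht => by
    split_ifs with hle
    · exact γ₁.mem_points _ (mapsTo_smoothStep (two_mul_mem_Icc ⟨ht.1, hle⟩))
    · exact γ₂.mem_points _ (mapsTo_smoothStep (two_mul_sub_one_mem_Icc ⟨(not_le.mp hle).le, ht.2⟩))
  algebraic_zero := fun i => by
    rw [if_pos (by norm_num : (0 : ℝ) ≤ 1 / 2), mul_zero, smoothStep_zero]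
    exact γ₁.algebraic_zero i
  algebraic_one := fun i => by
    rw [if_neg (by norm_num : ¬ (1 : ℝ) ≤ 1 / 2), show (2 : ℝ) * 1 - 1 = 1 by norm_num,
      smoothStep_one]
    exact γ₂.algebraic_one i

/-- The concatenation, unfolded. [folklore] -/
theorem CurvePath.concat_apply (γ₁ γ₂ : CurvePath Z) (hj : γ₁.toFun 1 = γ₂.toFun 0) (t : ℝ) :
    (γ₁.concat γ₂ hj).toFun t =
      if t ≤ 1 / 2 then γ₁.toFun (smoothStep (2 * t)) else γ₂.toFun (smoothStep (2 * t - 1)) :=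
  rfl

/-- The concatenation starts at `γ₁(0)`. [folklore] -/
theorem CurvePath.concat_zero (γ₁ γ₂ : CurvePath Z) (hj : γ₁.toFun 1 = γ₂.toFun 0) :
    (γ₁.concat γ₂ hj).toFun 0 = γ₁.toFun 0 := by
  rw [CurvePath.concat_apply, if_pos (by norm_num : (0 : ℝ) ≤ 1 / 2), mul_zero, smoothStep_zero]

/-- The concatenation ends at `γ₂(1)`. [folklore] -/
theorem CurvePath.concat_one (γ₁ γ₂ : CurvePath Z) (hj : γ₁.toFun 1 = γ₂.toFun 0) :
    (γ₁.concat γ₂ hj).toFun 1 = γ₂.toFun 1 := by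
  rw [CurvePath.concat_apply, if_neg (by norm_num : ¬ (1 : ℝ) ≤ 1 / 2),
    show (2 : ℝ) * 1 - 1 = 1 by norm_num, smoothStep_one]

/-- The concatenation passes through the junction point at `t = 1/2`. [folklore] -/
theorem CurvePath.concat_half (γ₁ γ₂ : CurvePath Z) (hj : γ₁.toFun 1 = γ₂.toFun 0) :
    (γ₁.concat γ₂ hj).toFun (1 / 2) = γ₂.toFun 0 := by
  rw [CurvePath.concat_apply, if_pos le_rfl, show (2 : ℝ) * (1 / 2) = 1 by norm_num,
    smoothStep_one, hj]

/-- **Additivity of the symbol under concatenation**: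
`(Z, ω, γ₁ ⋆ γ₂) − (Z, ω, γ₁) − (Z, ω, γ₂)` lies in the span of the elementary relations
(subdivision of `γ₁ ⋆ γ₂` at `t = 1/2`, whose pieces are the reparametrisations `γ₁ ∘ φ`,
`γ₂ ∘ φ`, and reparametrisation invariance). [cite: HuberWustholz2022, §3.3.1 (pp. 42–44)] -/
theorem span_concat (hZ : Z.IsSmoothAffineCurve)
    (ω : Fin Z.n → MvPolynomial (Fin Z.n) ℂ) (h : ∀ i, HasAlgCoeffs (ω i)) (γ₁ γ₂ : CurvePath Z)
    (hj : γ₁.toFun 1 = γ₂.toFun 0) :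
    InSpan (Finsupp.single (⟨Z, hZ, ω, h, γ₁.concat γ₂ hj⟩ : PeriodSymbol) (1 : ℂ) -
        Finsupp.single ⟨Z, hZ, ω, h, γ₁⟩ 1 - Finsupp.single ⟨Z, hZ, ω, h, γ₂⟩ 1) := by
  have hφ : ContDiffOn ℝ 1 smoothStep (Icc 0 1) := contDiff_smoothStep.contDiffOn
  -- the two pieces of `γ₁ ⋆ γ₂` are `γ₁ ∘ φ` and `γ₂ ∘ φ`
  have hsub := rel_subdivision hZ ω h (γ₁.concat γ₂ hj)
    (γ₁.reparam smoothStep hφ mapsTo_smoothStep smoothStep_zero smoothStep_one)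
    (γ₂.reparam smoothStep hφ mapsTo_smoothStep smoothStep_zero smoothStep_one)
    (c := 1 / 2) ⟨by norm_num, by norm_num⟩ (fun t ht => ?_) (fun t ht => ?_)
  · have hr₁ := span_single_reparam_sub_single hZ ω h γ₁ smoothStep hφ mapsTo_smoothStep
      smoothStep_zero smoothStep_one
    have hr₂ := span_single_reparam_sub_single hZ ω h γ₂ smoothStep hφ mapsTo_smoothStep
      smoothStep_zero smoothStep_one
    have := span_sub (span_add hr₁ hr₂) (span_of_rel hsub)
    convert this using 1
    abel
  · show γ₁.toFun (smoothStep t) = (γ₁.concat γ₂ hj).toFun (1 / 2 * t)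
    rw [CurvePath.concat_apply, if_pos (by linarith [ht.2])]
    congr 2; ring
  · show γ₂.toFun (smoothStep t) = (γ₁.concat γ₂ hj).toFun (1 / 2 + (1 - 1 / 2) * t)
    rw [CurvePath.concat_apply]
    rcases lt_or_eq_of_le ht.1 with hpos | h0
    · rw [if_neg (by linarith)]
      congr 2; ring
    · subst h0
      rw [if_pos (by norm_num)]
      norm_num [hj]

/-! ### Reversal and conjugation -/

/-- The reversed path `t ↦ γ(1 − t)`. [folklore] -/
def CurvePath.reverse (γ : CurvePath Z) : CurvePath Z where
  toFun := fun t => γ.toFun (1 - t)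
  contDiffOn := γ.contDiffOn.comp (contDiff_const.sub contDiff_id).contDiffOn
    fun _ ht => one_sub_mem_Icc ht
  mem_points := fun t ht => γ.mem_points (1 - t) (one_sub_mem_Icc ht)
  algebraic_zero := fun i => by simpa using γ.algebraic_one i
  algebraic_one := fun i => by simpa using γ.algebraic_zero i

/-- **Reversal**: `(Z, ω, γ) + (Z, ω, γ⁻)` lies in the span of the elementary relations
(`exists_isElementaryRelation_add_reverse`). [cite: HuberWustholz2022, §3.3.1 (p. 42)] -/
theorem span_single_add_single_reverse (hZ : Z.IsSmoothAffineCurve)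
    (ω : Fin Z.n → MvPolynomial (Fin Z.n) ℂ) (h : ∀ i, HasAlgCoeffs (ω i)) (γ : CurvePath Z) :
    InSpan (Finsupp.single (⟨Z, hZ, ω, h, γ⟩ : PeriodSymbol) (1 : ℂ) +
        Finsupp.single ⟨Z, hZ, ω, h, γ.reverse⟩ 1) := by
  obtain ⟨ρ₁, ρ₂, h₁, h₂, he⟩ :=
    exists_isElementaryRelation_add_reverse hZ ω h γ γ.reverse fun _ _ => rfl
  rw [he]
  exact span_add (span_of_rel h₁) (span_of_rel h₂)

/-- **Conjugation invariance** (moving the base point of a loop along a path): for a path `δ`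
from `P` to `Q` and a loop `ℓ` at `Q`, the loop `δ ⋆ (ℓ ⋆ δ⁻)` at `P` satisfies
`(Z, ω, δ ⋆ (ℓ ⋆ δ⁻)) ∼ (Z, ω, ℓ)` (additivity under concatenation and reversal; in `H₁` the
classes agree). [cite: HuberWustholz2022, §3.3.1 (pp. 42–44)] -/
theorem span_conj (hZ : Z.IsSmoothAffineCurve)
    (ω : Fin Z.n → MvPolynomial (Fin Z.n) ℂ) (h : ∀ i, HasAlgCoeffs (ω i)) (δ ℓ : CurvePath Z)
    (hℓ₀ : ℓ.toFun 0 = δ.toFun 1) (hℓ₁ : ℓ.toFun 1 = δ.toFun 1) :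
    InSpan (Finsupp.single (⟨Z, hZ, ω, h,
        δ.concat (ℓ.concat δ.reverse (by rw [hℓ₁]; simp [CurvePath.reverse]))
          (by rw [CurvePath.concat_zero, hℓ₀])⟩ : PeriodSymbol) (1 : ℂ) -
        Finsupp.single ⟨Z, hZ, ω, h, ℓ⟩ 1) := by
  have h1 := span_concat hZ ω h δ (ℓ.concat δ.reverse (by rw [hℓ₁]; simp [CurvePath.reverse]))
    (by rw [CurvePath.concat_zero, hℓ₀])
  have h2 := span_concat hZ ω h ℓ δ.reverse (by rw [hℓ₁]; simp [CurvePath.reverse])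
  have h3 := span_single_add_single_reverse hZ ω h δ
  have := span_add (span_add h1 h2) h3
  convert this using 1
  abel

end CurvePeriods

end Literature.NumberTheory.Transcendental

end
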